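import Summits.QuantumFields.YangMills.Theorems.SwapTwistDeficitToronLogShell
import Literature.MathematicalPhysics.QuantumLattice.SU2HaarSmallBallUpper
import HarnessLib

/-!
# The 4-letter commutator small ball, CEILING side — I: one straightened letter confines the others to a rotated slab

Companion (upper bound) to ✓`ToronLog.haar_pi_nearlyCommuting_ge` (w2 g54, `Theorems/SwapTwistDeficitToronLog.lean`): the product-Haar mass of
the quadruples `(C_μ) ∈ SU(2)⁴` whose unit quaternions pairwise commute up to `t` is ALSO `≤ C·t⁶·log(1/t)` — so the `k = 4` zero-mode block of
the toron valley (four commuting holonomies; the central strata of crux ⟨stmt-QuantumFields-24497⟩ `ToronValleyVolume.ToronTubeVolumeLaw`) has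
small-ball exponent EXACTLY `6 = 2·3` with EXACTLY ONE logarithm (pole `3`, multiplicity `2` in the quartic variable `s = t²`), the rigorous form
of the planner's «ONE LOG» kit rows j330298/j332219 on ⟨24497⟩.

This file (ball model of Haar measure, ✓`coneMeasure`, ✓`quatBox`, ✓`conjIso` of `SwapTwistDeficitToronLogQuaternion`):
* §1 quaternion lemmas: real part and `‖Im‖` are conjugation invariant; `exists_unit_straighten` — for `Im y ≠ 0` some unit `u` has
  `ū y u = re y + ‖Im y‖·i` (the cone conjugator ✓`coneQ` off the negative `i`-ray, the letter `j` on it);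
* §2 ★ `section_subset_preimage_box`: if `‖Im w‖ ≤ ‖Im y‖ =: m`, `‖w‖ < 1` and `‖yw − wy‖ ≤ t` then `ū w u` lies in the coordinate box
  `[-1,1] × [-m,m] × [-t/(2m), t/(2m)]²` (after straightening `y`, `‖[y,w]‖ = 2m·‖(Im w)_⊥‖`); hence ★ `coneMeasure_section_le`:
  the cone mass of the section `{w | ‖Im w‖ ≤ ‖Im y‖, ‖yw − wy‖ ≤ t}` is `≤ c·4t²/‖Im y‖` (`c = vol(B⁴)⁻¹`), and trivially `≤ 1`;
* §3 `coneMeasure_imBall_le`: `coneMeasure {‖Im y‖ ≤ r} ≤ c·16r³` (a coordinate box), the dyadic shells of part II.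
HONEST LABEL: finite-dimensional volume bookkeeping toward the fixed-`L` zero-mode factor of ⟨24497⟩; nothing about ⟨24497⟩/⟨24196⟩ or any rung is
proved; the Yang–Mills mass gap is NOT proved; no summit is proved by a line.  Seat ym-line-fcl-p3 g43 (cell ym-idea-1, free hands;
`--supports stmt-QuantumFields-24497`).  THEOREMS ONLY (0 `def`, 0 `sorry`), standard axioms.  References: [cite: Vanbaal2001]; [cite: Luscher1983, §2]; [folklore].
-/

set_option autoImplicit false

noncomputable section

open MeasureTheory Quaternion Set
open scoped Quaternion ENNReal BigOperators
open Literature.MathematicalPhysics.QuantumLattice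
open Literature.MathematicalPhysics.QuantumFieldTheory (haarProbability)
open Summit.QuantumFields.YangMills.Theorems.SwapTwistDeficit.ToronLog

attribute [local instance] Literature.Analysis.FluidPDE.Tao2016.quatMeasurableSpace
  Literature.Analysis.FluidPDE.Tao2016.quatBorelSpace
  Literature.MathematicalPhysics.QuantumLattice.secondCountableTopology_su2

namespace Summit.QuantumFields.YangMills.Theorems.ToronValleyVolume.NearlyCommutingCeiling

/-! ## §1 Quaternion lemmas: conjugation invariants and the straightening unit -/

/-- Conjugation by a unit quaternion preserves the real part. [folklore] -/
theorem re_conj_of_norm_eq_one {u : ℍ} (hu : ‖u‖ = 1) (w : ℍ) : (star u * w * u).re = w.re := by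
  have hus : u * star u = 1 := by
    rw [Quaternion.self_mul_star, Quaternion.normSq_eq_norm_mul_self, hu, mul_one, Quaternion.coe_one]
  have hcomm : (star u * (w * u)).re = ((w * u) * star u).re := by simp only [Quaternion.re_mul]; ring
  rw [mul_assoc, hcomm, mul_assoc, hus, mul_one]

/-- Conjugation by a unit quaternion preserves the norm. [folklore] -/
theorem norm_conj_of_norm_eq_one {u : ℍ} (hu : ‖u‖ = 1) (w : ℍ) : ‖star u * w * u‖ = ‖w‖ := by
  rw [norm_mul, norm_mul, norm_star, hu, one_mul, mul_one]

/-- `‖Im w‖² = ‖w‖² − (re w)²`. [folklore] -/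
theorem sq_norm_im_eq (w : ℍ) : ‖w.im‖ ^ 2 = ‖w‖ ^ 2 - w.re ^ 2 := by
  rw [WeakCouplingRates.sq_norm_im, sq_norm_eq_sum_sq]; ring

/-- Conjugation by a unit quaternion preserves `‖Im ·‖`. [folklore] -/
theorem norm_im_conj_of_norm_eq_one {u : ℍ} (hu : ‖u‖ = 1) (w : ℍ) : ‖(star u * w * u).im‖ = ‖w.im‖ := by
  have h : ‖(star u * w * u).im‖ ^ 2 = ‖w.im‖ ^ 2 := by
    rw [sq_norm_im_eq, sq_norm_im_eq, re_conj_of_norm_eq_one hu, norm_conj_of_norm_eq_one hu]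
  exact (pow_left_inj₀ (norm_nonneg _) (norm_nonneg _) two_ne_zero).1 h

/-- Conjugation by a unit quaternion transports commutators: `[ū y u, ū w u] = ū [y, w] u`. [folklore] -/
theorem comm_conj_of_norm_eq_one {u : ℍ} (hu : ‖u‖ = 1) (y w : ℍ) :
    (star u * y * u) * (star u * w * u) - (star u * w * u) * (star u * y * u) = star u * (y * w - w * y) * u := by
  have hus : u * star u = 1 := by
    rw [Quaternion.self_mul_star, Quaternion.normSq_eq_norm_mul_self, hu, mul_one, Quaternion.coe_one]
  have h1 : ∀ a b : ℍ, (star u * a * u) * (star u * b * u) = star u * (a * b) * u := by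
    intro a b
    calc (star u * a * u) * (star u * b * u) = star u * a * (u * star u) * b * u := by simp only [mul_assoc]
      _ = star u * (a * b) * u := by rw [hus]; simp only [mul_one, mul_assoc]
  rw [h1, h1, mul_sub, sub_mul]

/-- Components of the imaginary part are bounded by its norm. [folklore] -/
theorem abs_imI_le_norm_im (w : ℍ) : |w.imI| ≤ ‖w.im‖ := by
  have h := WeakCouplingRates.sq_norm_im w
  exact abs_le_of_sq_le_sq' (by nlinarith [sq_nonneg w.imJ, sq_nonneg w.imK]) (norm_nonneg _) |> fun h' => abs_le.2 h'

/-- **Straightening unit**: for `Im y ≠ 0` there is a unit quaternion `u` with `ū y u = re y ± ‖Im y‖·i` (✓`axisPoint y` or its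
conjugate).  Off the negative `i`-ray it is the normalised cone conjugator ✓`coneQ y` (✓`coneQ_conj`, sign `+`); on that ray `u = 1`
(sign `−`). [folklore] -/
theorem exists_unit_straighten {y : ℍ} (hy : y.im ≠ 0) :
    ∃ u : ℍ, ‖u‖ = 1 ∧ (star u * y * u = axisPoint y ∨ star u * y * u = star (axisPoint y)) := by
  have hm : 0 < ‖y.im‖ := norm_pos_iff.2 hy
  have hrel := WeakCouplingRates.sq_norm_im y
  by_cases hray : 0 < ‖y.im‖ + y.imI
  · -- the cone conjugator
    have hN : 0 < normSq (coneQ y) := by rw [normSq_coneQ]; positivity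
    have hq : coneQ y ≠ 0 := (normSq_ne_zero).1 hN.ne'
    have hqn : ‖coneQ y‖ ≠ 0 := norm_ne_zero_iff.2 hq
    refine ⟨‖coneQ y‖⁻¹ • coneQ y, by rw [norm_smul, norm_inv, norm_norm, inv_mul_cancel₀ hqn], Or.inl ?_⟩
    rw [Quaternion.star_smul, star_coneQ, smul_mul_assoc, smul_mul_assoc, mul_smul_comm, smul_smul, coneQ_conj, smul_smul,
      ← mul_inv, ← Quaternion.normSq_eq_norm_mul_self, inv_mul_cancel₀ hN.ne', one_smul]
  · -- on the negative `i`-ray: `y = re y − ‖Im y‖ i` is already straight (sign `−`)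
    have hray' : ‖y.im‖ + y.imI ≤ 0 := not_lt.1 hray
    have hI : y.imI = -‖y.im‖ := by
      have h1 : |y.imI| ≤ ‖y.im‖ := abs_imI_le_norm_im y
      have h2 := (abs_le.1 h1).1
      linarith
    have hJK : y.imJ ^ 2 + y.imK ^ 2 = 0 := by rw [hI] at hrel; nlinarith
    have hJ : y.imJ = 0 := by nlinarith [sq_nonneg y.imJ, sq_nonneg y.imK]
    have hK : y.imK = 0 := by nlinarith [sq_nonneg y.imJ, sq_nonneg y.imK]
    refine ⟨1, norm_one, Or.inr ?_⟩
    rw [star_one, one_mul, mul_one]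
    ext <;> simp [axisPoint, hJ, hK, hI]

/-! ## §2 The section of the nearly-commuting event over one straightened letter -/

/-- A straightened letter: `‖[y′, w]‖² = 4m²((w_J)² + (w_K)²)` for `y′ = re y + m·i = axisPoint y`, `m = ‖Im y‖`. [folklore] -/
theorem norm_comm_sq_axisPoint (y w : ℍ) :
    ‖axisPoint y * w - w * axisPoint y‖ ^ 2 = 4 * ‖y.im‖ ^ 2 * (w.imJ ^ 2 + w.imK ^ 2) := by
  rw [norm_comm_sq]; simp [axisPoint]; ring

/-- The same for the conjugate straightened letter `re y − m·i`. [folklore] -/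
theorem norm_comm_sq_star_axisPoint (y w : ℍ) :
    ‖star (axisPoint y) * w - w * star (axisPoint y)‖ ^ 2 = 4 * ‖y.im‖ ^ 2 * (w.imJ ^ 2 + w.imK ^ 2) := by
  rw [norm_comm_sq]; simp [axisPoint]; ring

/-- ★ **Section ⊆ rotated slab.**  If `Im y ≠ 0`, `u` straightens `y` (`ū y u = re y + m·i`, `m = ‖Im y‖`), and `w` has `‖w‖ < 1`,
`‖Im w‖ ≤ m`, `‖yw − wy‖ ≤ t` (`t ≥ 0`), then `ū w u` lies in the box `[-1,1] × [-m,m] × [-t/(2m), t/(2m)]²`. [folklore] -/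
theorem section_subset_preimage_box {y u : ℍ} {t : ℝ} (ht : 0 ≤ t) (hy : y.im ≠ 0) (hu : ‖u‖ = 1)
    (hstr : star u * y * u = axisPoint y ∨ star u * y * u = star (axisPoint y)) :
    {w : ℍ | ‖w.im‖ ≤ ‖y.im‖ ∧ ‖y * w - w * y‖ ≤ t} ∩ Metric.ball 0 1 ⊆
      (conjIso u hu) ⁻¹' quatBox ![-1, -‖y.im‖, -(t / (2 * ‖y.im‖)), -(t / (2 * ‖y.im‖))]
        ![1, ‖y.im‖, t / (2 * ‖y.im‖), t / (2 * ‖y.im‖)] := by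
  have hm : 0 < ‖y.im‖ := norm_pos_iff.2 hy
  intro w hw
  simp only [Set.mem_inter_iff, Set.mem_setOf_eq, Metric.mem_ball, dist_zero_right] at hw
  obtain ⟨⟨hIm, hcomm⟩, hball⟩ := hw
  simp only [Set.mem_preimage, conjIso_apply, quatBox, Set.mem_setOf_eq, Matrix.cons_val_zero, Matrix.cons_val_one,
    Matrix.cons_val]
  set w' : ℍ := star u * w * u with hw'
  -- real part and first imaginary coordinate
  have hre : |w'.re| ≤ 1 := by
    have h1 : |w'.re| ≤ ‖w'‖ := abs_re_le_norm w'
    rw [hw', norm_conj_of_norm_eq_one hu] at h1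
    exact h1.trans hball.le
  have hI : |w'.imI| ≤ ‖y.im‖ := by
    have h1 : |w'.imI| ≤ ‖w'.im‖ := abs_imI_le_norm_im w'
    rw [hw', norm_im_conj_of_norm_eq_one hu] at h1
    exact h1.trans hIm
  -- the transverse coordinates from the commutator
  have hc : ‖(star u * y * u) * w' - w' * (star u * y * u)‖ ≤ t := by
    rw [hw', comm_conj_of_norm_eq_one hu, norm_conj_of_norm_eq_one hu]
    exact hcomm
  have hsq : 4 * ‖y.im‖ ^ 2 * (w'.imJ ^ 2 + w'.imK ^ 2) ≤ t ^ 2 := by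
    rcases hstr with h | h
    · rw [← norm_comm_sq_axisPoint, ← h]
      exact pow_le_pow_left₀ (norm_nonneg _) hc 2
    · rw [← norm_comm_sq_star_axisPoint, ← h]
      exact pow_le_pow_left₀ (norm_nonneg _) hc 2
  have hb : (t / (2 * ‖y.im‖)) ^ 2 = t ^ 2 / (4 * ‖y.im‖ ^ 2) := by rw [div_pow]; ring
  have h4 : 0 < 4 * ‖y.im‖ ^ 2 := by positivity
  have hJ2 : w'.imJ ^ 2 ≤ (t / (2 * ‖y.im‖)) ^ 2 := by
    rw [hb, le_div_iff₀ h4]; nlinarith [sq_nonneg w'.imK]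
  have hK2 : w'.imK ^ 2 ≤ (t / (2 * ‖y.im‖)) ^ 2 := by
    rw [hb, le_div_iff₀ h4]; nlinarith [sq_nonneg w'.imJ]
  have hr0 : 0 ≤ t / (2 * ‖y.im‖) := by positivity
  have hJ := abs_le.1 (abs_le_of_sq_le_sq' hJ2 hr0 |> fun h => abs_le.2 h)
  have hK := abs_le.1 (abs_le_of_sq_le_sq' hK2 hr0 |> fun h => abs_le.2 h)
  obtain ⟨hre1, hre2⟩ := abs_le.1 hre
  obtain ⟨hI1, hI2⟩ := abs_le.1 hI
  exact ⟨hre1, hre2, hI1, hI2, hJ.1, hJ.2, hK.1, hK.2⟩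

/-- The section is a closed, hence measurable, set. [folklore] -/
theorem measurableSet_section (y : ℍ) (t : ℝ) : MeasurableSet {w : ℍ | ‖w.im‖ ≤ ‖y.im‖ ∧ ‖y * w - w * y‖ ≤ t} := by
  have h1 : MeasurableSet {w : ℍ | ‖w.im‖ ≤ ‖y.im‖} :=
    measurableSet_le (continuous_norm.comp continuous_im).measurable measurable_const
  have h2 : MeasurableSet {w : ℍ | ‖y * w - w * y‖ ≤ t} :=
    measurableSet_le (((continuous_const.mul continuous_id).sub (continuous_id.mul continuous_const)).norm).measurable
      measurable_const
  exact h1.inter h2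

/-- ★ **Volume of the section**: `vol({w | ‖Im w‖ ≤ ‖Im y‖, ‖yw − wy‖ ≤ t} ∩ B⁴) ≤ 4t²/‖Im y‖` for `Im y ≠ 0`. [folklore] -/
theorem volume_section_le {y : ℍ} {t : ℝ} (ht : 0 ≤ t) (hy : y.im ≠ 0) :
    volume ({w : ℍ | ‖w.im‖ ≤ ‖y.im‖ ∧ ‖y * w - w * y‖ ≤ t} ∩ Metric.ball 0 1) ≤ ENNReal.ofReal (4 * t ^ 2 / ‖y.im‖) := by
  have hm : 0 < ‖y.im‖ := norm_pos_iff.2 hy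
  obtain ⟨u, hu, hstr⟩ := exists_unit_straighten hy
  refine (measure_mono (section_subset_preimage_box ht hy hu hstr)).trans ?_
  rw [(conjIso u hu).measurePreserving.measure_preimage (measurableSet_quatBox _ _).nullMeasurableSet, volume_quatBox]
  · apply le_of_eq
    congr 1
    simp only [Matrix.cons_val_zero, Matrix.cons_val_one, Matrix.cons_val]
    field_simp
    ring
  · intro i
    have : 0 ≤ t / (2 * ‖y.im‖) := by positivity
    fin_cases i <;> simp <;> linarith [hm.le]

/-- `coneMeasure A = c · vol(A ∩ B⁴)` for measurable `A`. [folklore] -/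
theorem coneMeasure_eq (A : Set ℍ) (hA : MeasurableSet A) :
    coneMeasure A = ((volume : Measure ℍ) (Metric.ball 0 1))⁻¹ * volume (A ∩ Metric.ball 0 1) := by
  rw [coneMeasure, Measure.smul_apply, Measure.restrict_apply hA, smul_eq_mul]

/-- ★ **Cone mass of the section**: `≤ c·4t²/‖Im y‖`. [folklore] -/
theorem coneMeasure_section_le {y : ℍ} {t : ℝ} (ht : 0 ≤ t) (hy : y.im ≠ 0) :
    coneMeasure {w : ℍ | ‖w.im‖ ≤ ‖y.im‖ ∧ ‖y * w - w * y‖ ≤ t} ≤ ENNReal.ofReal (coneConst * (4 * t ^ 2 / ‖y.im‖)) := by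
  rw [coneMeasure_eq _ (measurableSet_section y t), ENNReal.ofReal_mul coneConst_pos.le, ← inv_volume_ball_eq]
  exact mul_le_mul_right (volume_section_le ht hy) _

/-- The cone mass of any set is at most `1`. [folklore] -/
theorem coneMeasure_le_one (A : Set ℍ) : coneMeasure A ≤ 1 := by
  haveI := isProbabilityMeasure_coneMeasure
  exact prob_le_one

/-! ## §3 The cone mass of `{‖Im y‖ ≤ r}` -/

/-- `{‖Im y‖ ≤ r} ∩ B⁴` lies in the coordinate box `[-1,1] × [-r,r]³`. [folklore] -/
theorem imBall_inter_ball_subset (r : ℝ) :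
    {y : ℍ | ‖y.im‖ ≤ r} ∩ Metric.ball 0 1 ⊆ quatBox ![-1, -r, -r, -r] ![1, r, r, r] := by
  intro y hy
  simp only [Set.mem_inter_iff, Set.mem_setOf_eq, Metric.mem_ball, dist_zero_right] at hy
  obtain ⟨hr, hball⟩ := hy
  have hrel := WeakCouplingRates.sq_norm_im y
  have hre := abs_le.1 ((abs_re_le_norm y).trans hball.le)
  have hI := abs_le.1 ((abs_imI_le_norm_im y).trans hr)
  have hJ' : |y.imJ| ≤ ‖y.im‖ :=
    abs_le_of_sq_le_sq' (by nlinarith [sq_nonneg y.imI, sq_nonneg y.imK]) (norm_nonneg _) |> fun h' => abs_le.2 h'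
  have hK' : |y.imK| ≤ ‖y.im‖ :=
    abs_le_of_sq_le_sq' (by nlinarith [sq_nonneg y.imI, sq_nonneg y.imJ]) (norm_nonneg _) |> fun h' => abs_le.2 h'
  have hJ := abs_le.1 (hJ'.trans hr)
  have hK := abs_le.1 (hK'.trans hr)
  simp only [quatBox, Set.mem_setOf_eq, Matrix.cons_val_zero, Matrix.cons_val_one, Matrix.cons_val]
  exact ⟨hre.1, hre.2, hI.1, hI.2, hJ.1, hJ.2, hK.1, hK.2⟩

/-- `{‖Im y‖ ≤ r}` is measurable. [folklore] -/
theorem measurableSet_imBall (r : ℝ) : MeasurableSet {y : ℍ | ‖y.im‖ ≤ r} :=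
  measurableSet_le (continuous_norm.comp continuous_im).measurable measurable_const

/-- ★ `coneMeasure {‖Im y‖ ≤ r} ≤ c · 16 r³`. [folklore] -/
theorem coneMeasure_imBall_le {r : ℝ} (hr : 0 ≤ r) :
    coneMeasure {y : ℍ | ‖y.im‖ ≤ r} ≤ ENNReal.ofReal (coneConst * (16 * r ^ 3)) := by
  rw [coneMeasure_eq _ (measurableSet_imBall r), ENNReal.ofReal_mul coneConst_pos.le, ← inv_volume_ball_eq]
  refine mul_le_mul_right ((measure_mono (imBall_inter_ball_subset r)).trans ?_) _
  rw [volume_quatBox]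
  · apply le_of_eq
    congr 1
    simp only [Matrix.cons_val_zero, Matrix.cons_val_one, Matrix.cons_val]
    ring
  · intro i
    fin_cases i <;> simp <;> linarith

/-- `{r < ‖Im y‖}` is measurable. [folklore] -/
theorem measurableSet_imBall_compl (r : ℝ) : MeasurableSet {y : ℍ | r < ‖y.im‖} :=
  measurableSet_lt measurable_const (continuous_norm.comp continuous_im).measurable

/-- `{1 < ‖Im y‖}` is a cone-null set (`‖Im y‖ ≤ ‖y‖ < 1` on the ball). [folklore] -/
theorem coneMeasure_imBall_compl_one : coneMeasure {y : ℍ | 1 < ‖y.im‖} = 0 := by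
  rw [coneMeasure_eq _ (measurableSet_imBall_compl 1)]
  have h : {y : ℍ | 1 < ‖y.im‖} ∩ Metric.ball 0 1 = ∅ := by
    ext y
    simp only [Set.mem_inter_iff, Set.mem_setOf_eq, Metric.mem_ball, dist_zero_right, Set.mem_empty_iff_false, iff_false,
      not_and, not_lt]
    intro h1
    have h2 : ‖y.im‖ ≤ ‖y‖ := by
      have := sq_norm_im_eq y
      nlinarith [sq_nonneg y.re, norm_nonneg y, norm_nonneg y.im]
    linarith
  rw [h, measure_empty, mul_zero]

end Summit.QuantumFields.YangMills.Theorems.ToronValleyVolume.NearlyCommutingCeiling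

end
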